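import Literature.Analysis.Hypoelliptic.EllipticPointEstimate
import Literature.Analysis.Distribution.EllipticRegularityProofs
import Mathlib.Analysis.Normed.Module.HahnBanach
import Mathlib.Analysis.InnerProductSpace.Dual
import Mathlib.LinearAlgebra.Isomorphisms
import HarnessLib

/-!
# Local solvability of `ᵗP u = δ` in `L²` for an elliptic operator, and the reproducing kernel
# of its solutions (the point-mass case of Folland 1995, Thm. (8.45), proved)

Analysis/Distribution support file, sequel of
`Literature/Analysis/Hypoelliptic/EllipticPointEstimate.lean` (the a priori estimate
`|ψ(y)| ≤ C ‖P ψ‖_{L²}` on small balls of the model space) and of `EllipticReproducingKernel`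
(the kernel `α` reproducing the solutions of `P v = 0`, granted the two named facts
`Folland1995_thm845` — local solvability — and `Folland1995_cor634` — hypoellipticity, the latter
being the theorem `Folland1995_cor634_holds` of `EllipticRegularityProofs`). Let
`P = ∑_{w ∈ S} a_w X_w` be a smooth presentation on a finite-dimensional real space `E` of positive
dimension with an additive Haar measure `μ`, elliptic of order `k` on the open set `Ω ∋ x₀`, with
`2k > dim E`. We prove:

* `smoothDiffOp_comp` — transport of `P` to the Euclidean model space;
* `exists_apriori_smoothDiffOp` — **`|φ(x₀)| ≤ C ‖P φ‖_{L²(μ)}`** for smooth `φ` supported in a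
  small neighbourhood `U` of `x₀` (transport of `exists_pointwise_le_smoothDiffOp`);
* `exists_pointMass_solution` — **there is `u₀ ∈ 𝓓'(U)` (indeed an `L²` function) with
  `ᵗP u₀ = δ_{x₀}`, i.e. `⟨u₀, P φ⟩ = φ(x₀)` for all test functions `φ` on `U`**: by the a priori
  estimate the functional `P φ ↦ φ(x₀)` is well defined and bounded on the subspace
  `P(𝓓(U)) ⊆ L²(μ)`; extend it (Hahn–Banach) and represent it (Riesz) by `u ∈ L²(μ)`
  (Hörmander's duality proof of local solvability). This is the case `f = δ_{x₀}` of Folland's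
  Thm. (8.45), the only case used by the reproducing kernel;
* `exists_kernel_of_isEllipticOn_of_lt` — **the reproducing kernel, unconditionally** (for
  `2k > dim E`): an open `U ∋ x₀` and `α ∈ C_c^∞(E)` supported in `U` with `v(x₀) = ∫ α v dμ`
  for every smooth `v` with `P v = 0` on `U` — the assembly of `exists_kernel_of_isEllipticOn`
  with the point-mass solution above and `Folland1995_cor634_holds`.

The restriction `2k > dim E` costs nothing in the applications (an operator killing `v` may be
composed with itself); it makes `δ_{x₀}` an element of the dual Sobolev space `H^{-k}`.
Everything here is proved; no definitions, no named facts.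

## References

* G. B. Folland, *Introduction to Partial Differential Equations*, 2nd ed. (1995), Thm. (8.45),
  Cor. (6.34) [Folland2020].
* L. Hörmander, *The Analysis of Linear Partial Differential Operators I–II*, 2nd ed. (1990),
  §7.9 and Thm. 13.3.3 (fundamental solutions of elliptic operators; folklore).
-/

noncomputable section

open MeasureTheory Set Filter Function TopologicalSpace Real Metric Distributions
open scoped Topology InnerProductSpace ContDiff ENNReal NNReal

namespace Literature.Analysis.Distribution

open Literature.Analysis.Hypoelliptic

variable {E : Type*} [NormedAddCommGroup E] [NormedSpace ℝ E]
variable {V : Type*} [NormedAddCommGroup V] [InnerProductSpace ℝ V]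
variable {ι : Type*} {X : ι → E → E} {S : Finset (List ι)} {a : List ι → E → ℝ} {k : ℕ}

/-! ### Transport of the operator to the model space -/

section Transport

variable [FiniteDimensional ℝ E] [FiniteDimensional ℝ V]

omit [FiniteDimensional ℝ E] [FiniteDimensional ℝ V] in
/-- **`X_w (G ∘ T) = ((T_*X)_w G) ∘ T`.** [folklore] -/
theorem wordDeriv_comp (T : E ≃L[ℝ] V) (hX : ∀ i, ContDiff ℝ ∞ (X i)) :
    ∀ (w : List ι) {G : V → ℝ}, ContDiff ℝ ∞ G →
      wordDeriv X w (fun x => G (T x)) = fun x => wordDeriv (fun i => push T (X i)) w G (T x)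
  | [], _, _ => rfl
  | i :: w, G, hG => by
    have hY : ∀ i, ContDiff ℝ ∞ (push T (X i)) := fun i => contDiff_push T (hX i)
    rw [wordDeriv_cons, wordDeriv_comp T hX w hG]
    ext x
    rw [wordDeriv_cons]
    exact fieldDeriv_comp T (X i) ((contDiff_wordDeriv hY w hG).differentiable (by simp)) x

omit [FiniteDimensional ℝ E] [FiniteDimensional ℝ V] in
/-- **`P (G ∘ T) = (P^V G) ∘ T`** for the transported presentation `(T_*X, S, a ∘ T⁻¹)`.
[folklore] -/
theorem smoothDiffOp_comp (T : E ≃L[ℝ] V) (hX : ∀ i, ContDiff ℝ ∞ (X i)) (S : Finset (List ι))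
    (a : List ι → E → ℝ) {G : V → ℝ} (hG : ContDiff ℝ ∞ G) (x : E) :
    smoothDiffOp X S a (fun x => G (T x)) x =
      smoothDiffOp (fun i => push T (X i)) S (pushCoef T a) G (T x) := by
  simp only [smoothDiffOp, pushCoef_apply, ContinuousLinearEquiv.symm_apply_apply]
  refine Finset.sum_congr rfl fun w _ => ?_
  rw [wordDeriv_comp T hX w hG]

omit [FiniteDimensional ℝ E] [FiniteDimensional ℝ V] in
/-- The support of `φ ∘ T⁻¹` is the image of the support of `φ`. [folklore] -/
theorem tsupport_comp_symm_subset (T : E ≃L[ℝ] V) (φ : E → ℝ) :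
    tsupport (fun y => φ (T.symm y)) ⊆ (T.symm : V → E) ⁻¹' tsupport φ :=
  closure_minimal (fun y hy => subset_closure (by simpa using hy))
    ((isClosed_tsupport φ).preimage T.symm.continuous)

end Transport

/-! ### The a priori estimate on `E` -/

section APriori

variable [FiniteDimensional ℝ E] [MeasurableSpace E] [BorelSpace E]

/-- **`|φ(x₀)| ≤ C ‖P φ‖_{L²(μ)}` near `x₀`.** For a smooth presentation elliptic of order `k` on
the open set `Ω ∋ x₀` with `2k > dim E` and an additive Haar measure `μ`, there are an open
`U ∋ x₀`, `U ⊆ Ω`, and `C ≥ 0` with `|φ x₀| ≤ C ‖P φ‖_{L²(μ)}` for every smooth `φ` with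
`tsupport φ ⊆ U` (transport of `exists_pointwise_le_smoothDiffOp` through
`T = toEuclidean : E ≃L ℝ^d`; the Haar measures `μ ∘ T⁻¹` and Lebesgue measure are proportional).
Folland 1995, Thm. (8.45) (folklore form). [folklore] -/
theorem exists_apriori_smoothDiffOp [Nontrivial E] (μ : Measure E) [μ.IsAddHaarMeasure]
    (hX : ∀ i, ContDiff ℝ ∞ (X i)) (ha : ∀ w, ContDiff ℝ ∞ (a w))
    {Ω : Set E} (hΩ : IsOpen Ω) (hell : IsEllipticOn X S a k Ω)
    (hk : (Module.finrank ℝ E : ℝ) < 2 * k) {x₀ : E} (hx₀ : x₀ ∈ Ω) :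
    ∃ U : Set E, IsOpen U ∧ x₀ ∈ U ∧ U ⊆ Ω ∧ IsCompact (closure U) ∧ ∃ C : ℝ, 0 ≤ C ∧
      ∀ φ : E → ℝ, ContDiff ℝ ∞ φ → tsupport φ ⊆ U →
        |φ x₀| ≤ C * (eLpNorm (smoothDiffOp X S a φ) 2 μ).toReal := by
  -- the model space
  set T : E ≃L[ℝ] EuclideanSpace ℝ (Fin (Module.finrank ℝ E)) := toEuclidean with hTdef
  haveI : Nontrivial (EuclideanSpace ℝ (Fin (Module.finrank ℝ E))) := T.injective.nontrivial
  set Y : ι → EuclideanSpace ℝ (Fin (Module.finrank ℝ E)) → EuclideanSpace ℝ (Fin (Module.finrank ℝ E)) :=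
    fun i => push T (X i) with hY
  set b : List ι → EuclideanSpace ℝ (Fin (Module.finrank ℝ E)) → ℝ := pushCoef T a with hb
  have hYs : ∀ i, ContDiff ℝ ∞ (Y i) := fun i => contDiff_push T (hX i)
  have hbs : ∀ w, ContDiff ℝ ∞ (b w) := fun w => (ha w).comp T.symm.contDiff
  have hkV : (Module.finrank ℝ (EuclideanSpace ℝ (Fin (Module.finrank ℝ E))) : ℝ) < 2 * k := by
    rw [← T.toLinearEquiv.finrank_eq]; exact hk
  -- a ball around `T x₀` inside `T(Ω)`
  have hΩ' : IsOpen ((T.symm : _ → E) ⁻¹' Ω) := hΩ.preimage T.symm.continuous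
  obtain ⟨r, hr, hrΩ⟩ := Metric.isOpen_iff.1 hΩ' (T x₀) (by simpa using hx₀)
  set R₀ : ℝ := r / 4 with hR₀
  have hR₀0 : 0 < R₀ := by positivity
  -- the cutoffs `χ ≤ χ₁`
  obtain ⟨χ, hχs, hχc, hχsupp, hχ1⟩ := exists_bump (isCompact_closedBall (T x₀) R₀) isOpen_ball
    (closedBall_subset_ball (by linarith : R₀ < 2 * R₀))
  obtain ⟨χ₁, hχ₁s, hχ₁c, hχ₁supp, hχ₁1⟩ := exists_bump (isCompact_closedBall (T x₀) (2 * R₀))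
    isOpen_ball (closedBall_subset_ball (by linarith : 2 * R₀ < 3 * R₀))
  have hχχ₁ : ∀ y ∈ tsupport χ, χ₁ y = 1 := fun y hy =>
    hχ₁1 y (ball_subset_closedBall (hχsupp hy))
  have hell' : ∀ y ∈ tsupport χ₁, ∀ ξ, ξ ≠ 0 → twSymb Y S b k y ξ ≠ 0 := by
    intro y hy ξ hξ
    have hyΩ : T.symm y ∈ Ω := hrΩ (ball_subset_ball (by linarith) (hχ₁supp hy))
    have h := twSymb_ne_zero_of_isEllipticOn hell T hyΩ hξ
    simpa [hY, hb] using h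
  have hχR : ∀ y ∈ ball (T x₀) R₀, χ y = 1 := fun y hy => hχ1 y (ball_subset_closedBall hy)
  obtain ⟨ε, hε, hεR, C, hC, hest⟩ := exists_pointwise_le_smoothDiffOp hYs hbs hell.1 hkV hχs hχc
    hχ₁s hχ₁c hχχ₁ hell' hR₀0 hχR
  -- comparison of the measures `μ.map T = c • volume`
  set ν : Measure (EuclideanSpace ℝ (Fin (Module.finrank ℝ E))) := μ.map T with hν
  haveI : ν.IsAddHaarMeasure := T.isAddHaarMeasure_map μ
  set c : ℝ≥0 := Measure.addHaarScalarFactor ν volume with hc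
  have hνeq : ν = c • (volume : Measure (EuclideanSpace ℝ (Fin (Module.finrank ℝ E)))) :=
    Measure.isAddLeftInvariant_eq_smul ν volume
  have hcpos : 0 < c := Measure.addHaarScalarFactor_pos_of_isAddHaarMeasure ν volume
  have hcomp : ∀ f : EuclideanSpace ℝ (Fin (Module.finrank ℝ E)) → ℝ, Continuous f →
      (eLpNorm f 2 volume).toReal =
        ((c : ℝ) ^ (2 : ℝ)⁻¹)⁻¹ * (eLpNorm (fun x => f (T x)) 2 μ).toReal := by
    intro f hf
    have e1 : eLpNorm f 2 ν = eLpNorm (fun x => f (T x)) 2 μ :=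
      eLpNorm_map_measure hf.aestronglyMeasurable T.continuous.measurable.aemeasurable
    have e2 : eLpNorm f 2 ν = c ^ (2 : ℝ≥0∞).toReal⁻¹ • eLpNorm f 2 volume := by
      rw [hνeq]; exact eLpNorm_smul_measure_of_ne_top' (by simp) c f
    have e3 : (eLpNorm (fun x => f (T x)) 2 μ).toReal = (c : ℝ) ^ (2 : ℝ)⁻¹ * (eLpNorm f 2 volume).toReal := by
      rw [← e1, e2, ENNReal.toReal_smul, NNReal.smul_def, NNReal.coe_rpow, smul_eq_mul]
      norm_num
    have hcr : 0 < (c : ℝ) ^ (2 : ℝ)⁻¹ := Real.rpow_pos_of_pos (NNReal.coe_pos.2 hcpos) _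
    rw [e3, ← mul_assoc, inv_mul_cancel₀ hcr.ne', one_mul]
  -- the neighbourhood `U = T⁻¹ B(T x₀, ε)`
  set U : Set E := (T : E → _) ⁻¹' ball (T x₀) ε with hU
  have hUo : IsOpen U := isOpen_ball.preimage T.continuous
  have hx₀U : x₀ ∈ U := by simp [hU, hε]
  have hUΩ : U ⊆ Ω := fun z hz => by
    have h : T.symm (T z) ∈ Ω := hrΩ (ball_subset_ball (by linarith) hz)
    simpa using h
  have hUc : IsCompact (closure U) := by
    have h1 : closure U ⊆ (T : E → _) ⁻¹' closedBall (T x₀) ε :=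
      closure_minimal (preimage_mono ball_subset_closedBall) (isClosed_closedBall.preimage T.continuous)
    refine IsCompact.of_isClosed_subset ?_ isClosed_closure h1
    rw [← T.image_symm_eq_preimage]
    exact (isCompact_closedBall _ _).image T.symm.continuous
  refine ⟨U, hUo, hx₀U, hUΩ, hUc, C * ((c : ℝ) ^ (2 : ℝ)⁻¹)⁻¹, by positivity, fun φ hφ hφU => ?_⟩
  -- transport `φ` to `ψ = φ ∘ T⁻¹`
  set ψ : EuclideanSpace ℝ (Fin (Module.finrank ℝ E)) → ℝ := fun y => φ (T.symm y) with hψ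
  have hψs : ContDiff ℝ ∞ ψ := hφ.comp T.symm.contDiff
  have hψsupp : tsupport ψ ⊆ ball (T x₀) ε := by
    refine (tsupport_comp_symm_subset T φ).trans fun y hy => ?_
    have h := hφU hy
    simpa [hU] using h
  have hψφ : (fun x => ψ (T x)) = φ := by ext x; simp [hψ]
  have hPcomp : (fun x => smoothDiffOp Y S b ψ (T x)) = smoothDiffOp X S a φ := by
    ext x; rw [← smoothDiffOp_comp T hX S a hψs x, hψφ]
  have hPψc : Continuous (smoothDiffOp Y S b ψ) := (contDiff_smoothDiffOp hYs (fun w _ => hbs w) hψs).continuous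
  have h := hest ψ hψs hψsupp (T x₀)
  rw [show ψ (T x₀) = φ x₀ by simp [hψ], hcomp _ hPψc, hPcomp] at h
  calc |φ x₀| ≤ C * (((c : ℝ) ^ (2 : ℝ)⁻¹)⁻¹ * (eLpNorm (smoothDiffOp X S a φ) 2 μ).toReal) := h
    _ = _ := by ring

end APriori

/-! ### The point-mass solution `ᵗP u₀ = δ_{x₀}` in `L²` -/

section PointMass

variable [FiniteDimensional ℝ E] [MeasurableSpace E] [BorelSpace E]

/-- **Local solvability of `ᵗP u = δ_{x₀}` in `L²` (the point-mass case of Folland's Thm. (8.45)).**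
For a smooth presentation `P` elliptic of order `k` on the open `Ω ∋ x₀`, `2k > dim E`, and an
additive Haar measure `μ`, there are an open `U ∋ x₀`, `U ⊆ Ω`, and `u ∈ L²(μ)` such that
`∫ u · (P φ) dμ = φ(x₀)` for every smooth `φ` with `tsupport φ ⊆ U`; that is, the distribution
`u₀ = u dμ ∈ 𝓓'(U)` satisfies `⟨u₀, P φ⟩ = φ(x₀)`, `ᵗP u₀ = δ_{x₀}`. Proof (Hörmander's duality
argument): on the subspace `P(𝓓(U)) ⊆ L²(μ)` the functional `P φ ↦ φ(x₀)` is well defined and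
bounded by `exists_apriori_smoothDiffOp`; extend it to `L²(μ)` (Hahn–Banach) and represent it
(Riesz). Folland 1995, Thm. (8.45); Hörmander 1990, Thm. 13.3.3. [cite: Folland2020, Thm. (8.45)] -/
theorem exists_pointMass_solution [Nontrivial E] (μ : Measure E) [μ.IsAddHaarMeasure]
    (hX : ∀ i, ContDiff ℝ ∞ (X i)) (ha : ∀ w, ContDiff ℝ ∞ (a w))
    {Ω : Opens E} (hell : IsEllipticOn X S a k (Ω : Set E))
    (hk : (Module.finrank ℝ E : ℝ) < 2 * k) {x₀ : E} (hx₀ : x₀ ∈ (Ω : Set E)) :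
    ∃ U : Opens E, x₀ ∈ U ∧ U ≤ Ω ∧ ∃ u : E → ℝ, MemLp u 2 μ ∧
      (∀ φ : 𝓓(U, ℝ), ∫ x, u x * smoothDiffOp X S a φ x ∂μ = φ x₀) ∧
      ∃ u₀ : 𝓓'(U, ℝ), ∀ φ ψ : 𝓓(U, ℝ), (ψ : E → ℝ) = smoothDiffOp X S a φ → u₀ ψ = φ x₀ := by
  obtain ⟨U, hUo, hx₀U, hUΩ, hUc, C, hC, hest⟩ :=
    exists_apriori_smoothDiffOp μ hX ha Ω.isOpen hell hk hx₀
  let Uo : Opens E := ⟨U, hUo⟩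
  have haS : ∀ w ∈ S, ContDiff ℝ ∞ (a w) := fun w _ => ha w
  -- `P φ ∈ L²(μ)` for test functions `φ`
  have hPs : ∀ φ : 𝓓(Uo, ℝ), ContDiff ℝ ∞ (smoothDiffOp X S a φ) := fun φ =>
    contDiff_smoothDiffOp hX haS φ.contDiff
  have hPc : ∀ φ : 𝓓(Uo, ℝ), HasCompactSupport (smoothDiffOp X S a φ) := fun φ =>
    φ.hasCompactSupport.mono' ((subset_tsupport _).trans (tsupport_smoothDiffOp_subset S a _))
  have hmem : ∀ φ : 𝓓(Uo, ℝ), MemLp (smoothDiffOp X S a φ) 2 μ := fun φ =>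
    (hPs φ).continuous.memLp_of_hasCompactSupport (hPc φ)
  -- the linear map `φ ↦ [P φ] ∈ L²(μ)`
  let Tm : 𝓓(Uo, ℝ) →ₗ[ℝ] Lp ℝ 2 μ :=
    { toFun := fun φ => (hmem φ).toLp _
      map_add' := fun φ ψ => by
        refine Lp.ext_iff.2 ?_
        filter_upwards [(hmem (φ + ψ)).coeFn_toLp, (hmem φ).coeFn_toLp, (hmem ψ).coeFn_toLp,
          Lp.coeFn_add ((hmem φ).toLp _) ((hmem ψ).toLp _)] with x h1 h2 h3 h4
        rw [h4, Pi.add_apply, h1, h2, h3]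
        have e : ((φ + ψ : 𝓓(Uo, ℝ)) : E → ℝ) = (φ : E → ℝ) + (ψ : E → ℝ) := rfl
        rw [e, smoothDiffOp_add hX S a φ.contDiff ψ.contDiff, Pi.add_apply]
      map_smul' := fun r φ => by
        refine Lp.ext_iff.2 ?_
        filter_upwards [(hmem (r • φ)).coeFn_toLp, (hmem φ).coeFn_toLp,
          Lp.coeFn_smul r ((hmem φ).toLp _)] with x h1 h2 h4
        rw [RingHom.id_apply, h4, Pi.smul_apply, h1, h2, smul_eq_mul]
        have e : ((r • φ : 𝓓(Uo, ℝ)) : E → ℝ) = fun y => r * φ y := rfl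
        rw [e, smoothDiffOp_const_mul S a r] }
  have hTm : ∀ φ : 𝓓(Uo, ℝ), Tm φ = (hmem φ).toLp _ := fun φ => rfl
  have hTm_norm : ∀ φ : 𝓓(Uo, ℝ), ‖Tm φ‖ = (eLpNorm (smoothDiffOp X S a φ) 2 μ).toReal := fun φ => by
    rw [hTm, Lp.norm_toLp]
  -- the evaluation functional and the kernel inclusion
  let ev : 𝓓(Uo, ℝ) →ₗ[ℝ] ℝ :=
    { toFun := fun φ => φ x₀, map_add' := fun _ _ => rfl, map_smul' := fun _ _ => rfl }
  have hbound : ∀ φ : 𝓓(Uo, ℝ), |φ x₀| ≤ C * ‖Tm φ‖ := fun φ => by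
    rw [hTm_norm]; exact hest φ φ.contDiff φ.tsupport_subset
  have hker : LinearMap.ker Tm ≤ LinearMap.ker ev := by
    intro φ hφ
    rw [LinearMap.mem_ker] at hφ ⊢
    have h := hbound φ
    rw [hφ, norm_zero, mul_zero] at h
    exact abs_nonpos_iff.1 h
  -- the functional on `range Tm`, its bound, and its Hahn–Banach extension
  let ℓ₀ : LinearMap.range Tm →ₗ[ℝ] ℝ :=
    ((LinearMap.ker Tm).liftQ ev hker).comp Tm.quotKerEquivRange.symm.toLinearMap
  have hℓ₀ : ∀ φ : 𝓓(Uo, ℝ), ℓ₀ ⟨Tm φ, LinearMap.mem_range_self Tm φ⟩ = φ x₀ := by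
    intro φ
    change ((LinearMap.ker Tm).liftQ ev hker) (Tm.quotKerEquivRange.symm ⟨Tm φ, _⟩) = φ x₀
    rw [LinearMap.quotKerEquivRange_symm_apply_image Tm φ (LinearMap.mem_range_self Tm φ)]
    rfl
  have hℓ₀b : ∀ w : LinearMap.range Tm, ‖ℓ₀ w‖ ≤ C * ‖w‖ := by
    rintro ⟨w, hw⟩
    obtain ⟨φ, rfl⟩ := LinearMap.mem_range.1 hw
    rw [hℓ₀ φ, Real.norm_eq_abs]
    exact hbound φ
  let ℓ₁ : LinearMap.range Tm →L[ℝ] ℝ := ℓ₀.mkContinuous C hℓ₀b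
  obtain ⟨g, hg, -⟩ := exists_extension_norm_eq (LinearMap.range Tm) ℓ₁
  -- Riesz representation in `L²(μ)`
  set u₂ : Lp ℝ 2 μ := (InnerProductSpace.toDual ℝ (Lp ℝ 2 μ)).symm g with hu₂
  have hu₂ : ∀ φ : 𝓓(Uo, ℝ), ∫ x, u₂ x * smoothDiffOp X S a φ x ∂μ = φ x₀ := by
    intro φ
    have h1 : ⟪u₂, Tm φ⟫_ℝ = φ x₀ := by
      rw [hu₂, InnerProductSpace.toDual_symm_apply, hg ⟨Tm φ, LinearMap.mem_range_self Tm φ⟩]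
      exact hℓ₀ φ
    rw [← h1, MeasureTheory.L2.inner_def]
    refine integral_congr_ae ?_
    filter_upwards [(hmem φ).coeFn_toLp] with x hx
    rw [hTm, hx]
    simp only [RCLike.inner_apply, conj_trivial]
    ring
  have hmemu : MemLp (u₂ : E → ℝ) 2 μ := Lp.memLp u₂
  -- the distribution `u₀ = u dμ`
  have hloc : LocallyIntegrableOn (u₂ : E → ℝ) (Uo : Set E) μ :=
    (hmemu.locallyIntegrable one_le_two).locallyIntegrableOn _
  let u₀ : 𝓓'(Uo, ℝ) :=
    (TestFunction.integralAgainstBilinCLM (ContinuousLinearMap.mul ℝ ℝ) μ (u₂ : E → ℝ) :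
      𝓓(Uo, ℝ) →L[ℝ] ℝ)
  refine ⟨Uo, hx₀U, hUΩ, (u₂ : E → ℝ), hmemu, hu₂, u₀, fun φ ψ hψ => ?_⟩
  change TestFunction.integralAgainstBilinCLM (ContinuousLinearMap.mul ℝ ℝ) μ (u₂ : E → ℝ) ψ = φ x₀
  rw [TestFunction.integralAgainstBilinCLM_eq_integral hloc, ← hu₂ φ]
  refine integral_congr_ae (Eventually.of_forall fun x => ?_)
  simp only [ContinuousLinearMap.mul_apply']
  rw [hψ, mul_comm]

end PointMass

/-! ### The reproducing kernel, unconditionally -/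

section Kernel

/-- **Solutions of an elliptic equation are reproduced by a smooth compactly supported kernel**
(unconditional form of `exists_kernel_of_isEllipticOn` for `2k > dim E`). Let
`P = ∑_{w ∈ S} a_w X_w` be a smooth presentation on a finite-dimensional real vector space `E` of
positive dimension, elliptic of order `k` on the open set `Ω ∋ x₀`, with `2k > dim E`, and `μ` an
additive Haar measure. Then there are an open `U` with `x₀ ∈ U ⊆ Ω` and `α ∈ C_c^∞(E)` with
`supp α ⊆ U` such that `v(x₀) = ∫ α v dμ` for every smooth `v : E → ℝ` with `P v = 0` on `U`.
Proof: `ᵗP` is elliptic (`exists_smoothDiffOp_transpose`), so `exists_pointMass_solution` gives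
`u₀ ∈ 𝓓'(U)` with `⟨u₀, P φ⟩ = φ(x₀)`, and hypoellipticity (`Folland1995_cor634_holds`) makes
`u₀` a smooth function `h` on `U ∖ {x₀}`; with a bump `χ` (`= 1` near `x₀`, supported in `U`) and
a cut-off `η` of the annulus carrying `P(χ v)`:
`v(x₀) = ⟨u₀, P(χ v)⟩ = ∫ h P(χ v) = ∫ (η h) P(χ v) = ∫ ᵗP(η h) χ v`, i.e. `α = χ ᵗP(η h)`.
Folland 1995, Thm. (8.45), Cor. (6.34); classical (fundamental solutions reproduce solutions,
Harish-Chandra 1966, Thm. 1 / Borel 1972, 3.18 for `Z(𝔤)`-finite `K`-finite functions).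
[cite: Folland2020, Thm. (8.45) and Cor. (6.34)] -/
theorem exists_kernel_of_isEllipticOn_of_lt
    {E : Type} [NormedAddCommGroup E] [NormedSpace ℝ E] [FiniteDimensional ℝ E] [Nontrivial E]
    [MeasurableSpace E] [BorelSpace E] (μ : Measure E) [μ.IsAddHaarMeasure]
    {ι : Type} [DecidableEq ι] {Ω : Opens E} {X : ι → E → E} {S : Finset (List ι)}
    {a : List ι → E → ℝ} {k : ℕ} (hX : ∀ i, ContDiff ℝ ∞ (X i)) (ha : ∀ w ∈ S, ContDiff ℝ ∞ (a w))
    (hell : IsEllipticOn X S a k (Ω : Set E)) (hk : (Module.finrank ℝ E : ℝ) < 2 * k)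
    {x₀ : E} (hx₀ : x₀ ∈ (Ω : Set E)) :
    ∃ U : Opens E, x₀ ∈ U ∧ U ≤ Ω ∧ ∃ α : E → ℝ, ContDiff ℝ ∞ α ∧ HasCompactSupport α ∧
      tsupport α ⊆ (U : Set E) ∧
      ∀ v : E → ℝ, ContDiff ℝ ∞ v → (∀ x ∈ (U : Set E), smoothDiffOp X S a v x = 0) →
        v x₀ = ∫ x, α x * v x ∂μ := by
  have h634 : Folland1995_cor634 := Folland1995_cor634_holds
  -- Step 1: the transpose presentation `(X, S', a')` of `ᵗP`, elliptic of order `k` on `Ω`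
  obtain ⟨S', a', ha', hk', hP', hsymb⟩ := exists_smoothDiffOp_transpose hX ha hell.1
  have hell' : IsEllipticOn X S' a' k (Ω : Set E) :=
    ⟨hk', fun x hx ξ hξ => by
      rw [hsymb]
      exact mul_ne_zero (pow_ne_zero _ (by norm_num)) (hell.2 x hx ξ hξ)⟩
  have hPP : ∀ g : E → ℝ, ContDiff ℝ ∞ g → smoothDiffOpTranspose X S' a' g = smoothDiffOp X S a g :=
    fun g hg => smoothDiffOpTranspose_eq_of_transpose hX ha ha' hP' hg
  -- normalise the coefficients outside `S` (to have them smooth for all words)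
  classical
  set aN : List ι → E → ℝ := fun w => if w ∈ S then a w else 0 with haNdef
  have haN : ∀ w, ContDiff ℝ ∞ (aN w) := fun w => by
    by_cases hw : w ∈ S
    · simpa [haNdef, hw] using ha w hw
    · simp only [haNdef, hw, if_false]; exact contDiff_const
  have hopN : ∀ g, smoothDiffOp X S aN g = smoothDiffOp X S a g := fun g => by
    ext y
    simp only [smoothDiffOp]
    exact Finset.sum_congr rfl fun w hw => by simp [haNdef, hw]
  have hellN : IsEllipticOn X S aN k (Ω : Set E) := by
    refine ⟨hell.1, fun y hy ξ hξ => ?_⟩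
    have e : principalSymbol X S aN k y ξ = principalSymbol X S a k y ξ := by
      simp only [principalSymbol]
      exact Finset.sum_congr rfl fun w hw => by simp [haNdef, (Finset.mem_filter.1 hw).1]
    rw [e]; exact hell.2 y hy ξ hξ
  -- Step 2: the point-mass solution: `⟨u₀, P φ⟩ = φ x₀` on `U`
  obtain ⟨U, hxU, hUΩ, -, -, -, u₀, hu₀⟩ := exists_pointMass_solution μ hX haN hellN hk hx₀
  have hu₀' : ∀ φ ψ : 𝓓(U, ℝ), (ψ : E → ℝ) = smoothDiffOp X S a φ → u₀ ψ = φ x₀ :=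
    fun φ ψ hψ => hu₀ φ ψ (by rw [hψ, hopN])
  -- Step 3: (6.34): `u₀` is a smooth function `h` on `U \ {x₀}`
  set U' : Set E := (U : Set E) \ {x₀} with hU'
  have hU'o : IsOpen U' := U.isOpen.sdiff isClosed_singleton
  have hU'U : U' ⊆ (U : Set E) := fun x hx => hx.1
  have himg : Distribution.ImageIsSmoothOn u₀ (smoothDiffOpTranspose X S' a') μ U' := by
    refine ⟨0, contDiffOn_const, fun φ ψ hφ hψ => ?_⟩
    rw [hu₀' φ ψ (by rw [hψ, hPP φ φ.contDiff])]
    simp only [Pi.zero_apply, zero_mul, integral_zero]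
    exact image_eq_zero_of_notMem_tsupport fun h => (hφ h).2 rfl
  obtain ⟨h, hh, hhu⟩ :=
    h634 E μ ι U X S' a' k hX ha' ⟨hk', fun x hx => hell'.2 x (hUΩ hx)⟩ u₀ U' hU'o hU'U himg
  -- Step 4: radii and cut-offs
  obtain ⟨ε, hε, hεU⟩ := Metric.isOpen_iff.1 U.isOpen x₀ hxU
  set r : ℝ := ε / 8 with hr
  have hr0 : 0 < r := by positivity
  have h4r : Metric.closedBall x₀ (4 * r) ⊆ (U : Set E) := fun y hy => hεU (by
    rw [Metric.mem_closedBall] at hy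
    rw [Metric.mem_ball]
    linarith)
  -- `χ = 1` on `closedBall x₀ r`, supported in `closedBall x₀ (2r)`
  let χ : ContDiffBump x₀ := ⟨r, 2 * r, hr0, by linarith⟩
  -- `η = 1` on `r/2 ≤ dist ≤ 3r`, `η = 0` on `closedBall x₀ (r/4)`, supported in `closedBall x₀ (4r)`
  let χ₀ : ContDiffBump x₀ := ⟨r / 4, r / 2, by positivity, by linarith⟩
  let χ₃ : ContDiffBump x₀ := ⟨3 * r, 4 * r, by positivity, by linarith⟩
  set η : E → ℝ := fun x => χ₃ x * (1 - χ₀ x) with hη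
  have hηs : ContDiff ℝ ∞ η := χ₃.contDiff.mul (contDiff_const.sub χ₀.contDiff)
  have hηc : HasCompactSupport η := χ₃.hasCompactSupport.mul_right
  have hη_tsupp : tsupport η ⊆ Metric.closedBall x₀ (4 * r) := by
    refine (tsupport_mul_subset_left (f := (χ₃ : E → ℝ)) (g := fun x => 1 - χ₀ x)).trans ?_
    rw [χ₃.tsupport_eq]
  have hη_one : ∀ x, r / 2 ≤ dist x x₀ → dist x x₀ ≤ 3 * r → η x = 1 := by
    intro x h1 h2
    have e3 : χ₃ x = 1 := χ₃.one_of_mem_closedBall (by rw [Metric.mem_closedBall]; exact h2)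
    have e0 : χ₀ x = 0 := χ₀.zero_of_le_dist (by exact h1)
    simp [hη, e3, e0]
  have hη_zero : ∀ x, dist x x₀ ≤ r / 4 → η x = 0 := by
    intro x h1
    have e0 : χ₀ x = 1 := χ₀.one_of_mem_closedBall (by rw [Metric.mem_closedBall]; exact h1)
    simp [hη, e0]
  have hη_ev0 : ∀ x, x ∉ U' → η =ᶠ[𝓝 x] 0 := by
    intro x hx
    by_cases hxU : x ∈ (U : Set E)
    · have hx0 : x = x₀ := by
        by_contra hne
        exact hx ⟨hxU, hne⟩
      subst hx0
      filter_upwards [Metric.closedBall_mem_nhds x (by positivity : (0 : ℝ) < r / 4)] with y hy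
      exact hη_zero y (by rwa [Metric.mem_closedBall] at hy)
    · have : x ∉ tsupport η := fun h => hxU (h4r (hη_tsupp h))
      exact notMem_tsupport_iff_eventuallyEq.1 this
  -- `h' = η h ∈ C_c^∞(E)`
  set h' : E → ℝ := fun x => η x * h x with hh'
  have hh's : ContDiff ℝ ∞ h' := by
    refine contDiff_iff_contDiffAt.2 fun x => ?_
    by_cases hx : x ∈ U'
    · exact hηs.contDiffAt.mul (hh.contDiffAt (hU'o.mem_nhds hx))
    · have hev : h' =ᶠ[𝓝 x] fun _ => 0 := by
        filter_upwards [hη_ev0 x hx] with y hy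
        simp [hh', hy]
      exact (contDiffAt_const (c := (0 : ℝ))).congr_of_eventuallyEq hev
  have hh'c : HasCompactSupport h' := hηc.mul_right
  -- the kernel
  set α : E → ℝ := fun x => χ x * smoothDiffOpTranspose X S a h' x with hα
  have hαs : ContDiff ℝ ∞ α := χ.contDiff.mul (contDiff_smoothDiffOpTranspose hX ha hh's)
  have hαc : HasCompactSupport α := χ.hasCompactSupport.mul_right
  have hα_tsupp : tsupport α ⊆ (U : Set E) := by
    refine (tsupport_mul_subset_left (f := (χ : E → ℝ))
      (g := smoothDiffOpTranspose X S a h')).trans ?_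
    rw [χ.tsupport_eq]
    exact (Metric.closedBall_subset_closedBall (by change 2 * r ≤ 4 * r; linarith)).trans h4r
  refine ⟨U, hxU, hUΩ, α, hαs, hαc, hα_tsupp, fun v hv hPv => ?_⟩
  -- Step 5: the identity for a solution `v`
  set w : E → ℝ := fun x => χ x * v x with hw
  have hws : ContDiff ℝ ∞ w := χ.contDiff.mul hv
  have hwc : HasCompactSupport w := χ.hasCompactSupport.mul_right
  have hw_tsupp : tsupport w ⊆ Metric.closedBall x₀ (2 * r) := by
    refine (tsupport_mul_subset_left (f := (χ : E → ℝ)) (g := v)).trans ?_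
    rw [χ.tsupport_eq]
  -- `P w` vanishes on `ball x₀ r` (where `w = v` locally and `P v = 0`) and off `closedBall x₀ (2r)`
  have hPw_ball : ∀ x ∈ Metric.ball x₀ r, smoothDiffOp X S a w x = 0 := by
    intro x hx
    have hev : w =ᶠ[𝓝 x] v := by
      filter_upwards [Metric.isOpen_ball.mem_nhds hx] with y hy
      have : χ y = 1 := χ.one_of_mem_closedBall (Metric.ball_subset_closedBall hy)
      simp [hw, this]
    rw [(smoothDiffOp_eventuallyEq X S a hev).eq_of_nhds]
    exact hPv x (h4r (Metric.closedBall_subset_closedBall (by linarith)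
      (Metric.ball_subset_closedBall hx)))
  have hPw_tsupp : tsupport (smoothDiffOp X S a w) ⊆ Metric.closedBall x₀ (2 * r) \ Metric.ball x₀ r := by
    intro x hx
    refine ⟨(tsupport_smoothDiffOp_subset S a w).trans hw_tsupp hx, fun hxb => ?_⟩
    -- `P w = 0` on the open ball, so the ball misses the topological support
    have : x ∉ tsupport (smoothDiffOp X S a w) := by
      rw [notMem_tsupport_iff_eventuallyEq]
      filter_upwards [Metric.isOpen_ball.mem_nhds hxb] with y hy
      exact hPw_ball y hy
    exact this hx
  have hPws : ContDiff ℝ ∞ (smoothDiffOp X S a w) := contDiff_smoothDiffOp hX ha hws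
  have hPwc : HasCompactSupport (smoothDiffOp X S a w) :=
    hwc.mono' ((subset_tsupport _).trans (tsupport_smoothDiffOp_subset S a w))
  have hPwU : tsupport (smoothDiffOp X S a w) ⊆ (U : Set E) := fun x hx =>
    h4r (Metric.closedBall_subset_closedBall (by linarith) (hPw_tsupp hx).1)
  have hPwU' : tsupport (smoothDiffOp X S a w) ⊆ U' := fun x hx =>
    ⟨hPwU hx, fun hx0 => (hPw_tsupp hx).2 (by
      rw [mem_singleton_iff] at hx0
      rw [hx0]
      exact Metric.mem_ball_self hr0)⟩
  -- the test functions `w` and `P w` on `U`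
  let φ₁ : 𝓓(U, ℝ) := ⟨w, hws, hwc, hw_tsupp.trans
    ((Metric.closedBall_subset_closedBall (by linarith)).trans h4r)⟩
  let ψ₁ : 𝓓(U, ℝ) := ⟨smoothDiffOp X S a w, hPws, hPwc, hPwU⟩
  -- (a) `⟨u₀, P w⟩ = w x₀ = v x₀`
  have ha1 : u₀ ψ₁ = v x₀ := by
    rw [hu₀' φ₁ ψ₁ rfl]
    change χ x₀ * v x₀ = v x₀
    rw [χ.one_of_mem_closedBall (Metric.mem_closedBall_self hr0.le), one_mul]
  -- (b) `⟨u₀, P w⟩ = ∫ h (P w) = ∫ h' (P w)`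
  have hb1 : u₀ ψ₁ = ∫ x, h' x * smoothDiffOp X S a w x ∂μ := by
    rw [hhu ψ₁ hPwU']
    refine integral_congr_ae (Eventually.of_forall fun x => ?_)
    change h x * smoothDiffOp X S a w x = η x * h x * smoothDiffOp X S a w x
    by_cases hx : smoothDiffOp X S a w x = 0
    · simp [hx]
    · have hxK := hPw_tsupp (subset_tsupport _ hx)
      rw [hη_one x (by
          have := hxK.2
          rw [Metric.mem_ball, not_lt] at this
          linarith) (by
          have := hxK.1
          rw [Metric.mem_closedBall] at this
          linarith), one_mul]
  -- (c) integrate by parts: `∫ h' (P w) = ∫ w ᵗP h' = ∫ α v`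
  have hc1 : ∫ x, h' x * smoothDiffOp X S a w x ∂μ = ∫ x, α x * v x ∂μ := by
    calc ∫ x, h' x * smoothDiffOp X S a w x ∂μ = ∫ x, smoothDiffOp X S a w x * h' x ∂μ :=
          integral_congr_ae (Eventually.of_forall fun x => mul_comm _ _)
      _ = ∫ x, w x * smoothDiffOpTranspose X S a h' x ∂μ :=
          integral_smoothDiffOp_mul hX ha hws hh's hh'c
      _ = ∫ x, α x * v x ∂μ := integral_congr_ae (Eventually.of_forall fun x => by
          change χ x * v x * smoothDiffOpTranspose X S a h' x =
            χ x * smoothDiffOpTranspose X S a h' x * v x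
          ring)
  rw [← ha1, hb1, hc1]

end Kernel

end Literature.Analysis.Distribution
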